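import Literature.Analysis.FluidPDE.KatoPicardLp
import Literature.Analysis.FluidPDE.OseenHeatKernelBridge
import Literature.Analysis.FluidPDE.AncientLPSLiouvilleBootstrap
import Literature.Analysis.FunctionSpaces.MinkowskiIntegral
import HarnessLib

/-!
# Small-data `L^p` stability of drift-mild Navier–Stokes fields with a finite
# Ladyzhenskaya–Prodi–Serrin quantity

Analysis/FluidPDE proof file (theorems only, no definitions, no named facts) on the discharge
path of the named fact `Literature.Analysis.FluidPDE.Seregin2014_ancient_liouville_LPS`
(`AncientLPSLiouville.lean`; G. Seregin, *Lecture Notes on Regularity Theory for the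
Navier–Stokes Equations*, World Scientific 2014, Ch. 6, §6.4.1, Theorem 4.12). The discharge
(`AncientLPSLiouvilleProofs.lean`) does **not** follow the printed ε-regularity argument; it runs
a small-data stability argument in `L^p = L^s(ℝ³)`, `3 < p < ∞`, for the Oseen (mild) form of the
equations, whose window-level statement is proved here:

* `IsKNSSDriftMild.exists_eta_ae_eLpNorm_le_four_mul` — there is `η = η(p) > 0` such that for
  every drift-mild pair `(U, b)` on `(0, T)` (`IsKNSSDriftMild`, the output of KNSS 2009,
  Lemma 3.1 for a bounded weak solution `u = U + b(t)`; `KNSSRegularityDecomposition.lean`) whose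
  full velocity `V = U + b` has `∫₀ᵀ ‖V(σ)‖_{L^p}^l dσ < ∞` for some `l > 2`, and every time
  `0 < s < T` with `‖V(s)‖_{L^p} (T - s)^{1/2 - 3/(2p)} ≤ η`, one has `‖V(t)‖_{L^p} ≤ 4‖V(s)‖_{L^p}`
  for a.e. `t ∈ (s, T)`.

## The argument

1. `IsKNSSDriftMild.add_drift_eq_heatExtension_sub_oseenDuhamel`: from the drift-mild identity
   `U(t) = e^{(t-s)Δ}U(s) - ∫ₛᵗ e^{(t-σ)Δ}P∇·(V ⊗ V) dσ` and `e^{τΔ}(f + c) = e^{τΔ}f + c`,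
   `V(t) = e^{(t-s)Δ}V(s) - B¹ₛ(V,V)(t) + (b(t) - b(s))` **everywhere** (the Duhamel term is the
   tree's `oseenDuhamel`, `driftDuhamel_zero_eq_oseenDuhamel`).
2. `eLpNorm_oseenDuhamel_one_le_lintegral` (Minkowski in time) and the two slice bounds of the
   tree — `‖T_σ[a,b]‖_p ≤ C₁ σ^{-1/2-3/(2p)} ‖a‖_p ‖b‖_p` (`KatoLp.exists_eLpNorm_oseenSlice_le_Lp`,
   Kato 1984 (2.3)) and `‖T_σ[a,b]‖_p ≤ C₂ σ^{-1/2} ‖a‖_∞ ‖b‖_p` (`exists_eLpNorm_oseenSlice_le`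
   with `p = q`) — give, for every splitting time `t₁ ∈ [s, t]`,
   `‖B¹ₛ(V,V)(t)‖_p ≤ C₁ ∫_{(s,t₁)} (t-σ)^{-1/2-3/(2p)} n(σ)² dσ + 2N C₂ ∫_{(t₁,t)} (t-σ)^{-1/2} n(σ) dσ`,
   `n(σ) = ‖V(σ)‖_p`, `N` the sup bound; in particular (Hölder in time, `l > 2`) the Duhamel term
   is in `L^p` for every `t`.
3. **The LPS hypothesis kills the drift**: if `V(s), V(t) ∈ L^p` then the constant
   `b(t) - b(s) = V(t) - e^{(t-s)Δ}V(s) + B¹ₛ(V,V)(t)` is in `L^p(ℝ³)`, hence zero (`p < ∞`,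
   `|ℝ³| = ∞`): between such times `V` solves the genuine Oseen integral equation.
4. Consequently `n` satisfies the Volterra inequality of
   `ae_le_four_mul_of_volterra_bootstrap` (`AncientLPSLiouvilleBootstrap.lean`) for a.e. `t`, with
   `δ = n(s)` and `a = 3/(2p) < 1/2`; the smallness `‖V(s)‖_p (T-s)^{1/2-3/(2p)} ≤ η` is its
   hypothesis `16 C₁ δ (T-s)^{1/2-a}/(1/2-a) ≤ 1`, and the bootstrap yields `n ≤ 4δ` a.e.

(For the printed exponents `3/s + 2/l = 1` one has `1/2 - 3/(2s) = 1/l`, so the smallness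
quantity is `|T - s|^{1/l} ‖V(s)‖_{L^s}`, which the finiteness of `∫ ‖V‖_s^l` makes small at
suitable early times — `AncientLPSLiouvilleProofs.lean`.)

## References

* G. Seregin, *Lecture Notes on Regularity Theory for the Navier–Stokes Equations*, World
  Scientific (2014), Ch. 6, §6.4.1, Theorem 4.12 (printed p. 166). [Seregin2014Notes]
* G. Koch, N. Nadirashvili, G. Seregin, V. Šverák, *Liouville theorems for the Navier–Stokes
  equations and applications*, Acta Math. 203 (2009) = arXiv:0709.3599, §3 Lemma 3.1, §4 (4.3).
  [KochNadirashviliSereginSverak2009]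
* T. Kato, *Strong `L^p`-solutions of the Navier–Stokes equation in `ℝ^m`, with applications to
  weak solutions*, Math. Z. 187 (1984) 471–480, §2, (2.3)–(2.4'). [Kato1984]
-/

noncomputable section

open MeasureTheory Set Function Filter
open scoped ENNReal NNReal Topology

namespace Literature.Analysis.FluidPDE

variable {E : Type*} [NormedAddCommGroup E] [InnerProductSpace ℝ E] [FiniteDimensional ℝ E]
  [MeasurableSpace E] [BorelSpace E]

/-! ### The caloric extension of `f + c` and the Oseen form of the drift-mild identity -/

section Identity

/-- `e^{τΔ}(f + c)(x) = e^{τΔ}f(x) + c` for bounded measurable `f`, a constant `c` and `τ > 0`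
(`∫ G_τ = 1`). [folklore] -/
theorem heatExtension_add_const_apply {f : E → E} (hf : AEStronglyMeasurable f volume) {C : ℝ}
    (hC : ∀ y, ‖f y‖ ≤ C) (c : E) {τ : ℝ} (hτ : 0 < τ) (x : E) :
    UnboundedOperators.heatExtension (fun y => f y + c) τ x =
      UnboundedOperators.heatExtension f τ x + c := by
  rw [UnboundedOperators.heatExtension_apply, UnboundedOperators.heatExtension_apply]
  have hint : Integrable (fun y => UnboundedOperators.heatKernel τ y • f (x - y)) volume := by
    have hm : AEStronglyMeasurable (fun y => UnboundedOperators.heatKernel τ y • f (x - y)) volume :=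
      (UnboundedOperators.continuous_heatKernel τ).aestronglyMeasurable.smul
        (hf.comp_measurePreserving (Measure.measurePreserving_sub_left volume x))
    refine (((UnboundedOperators.integrable_heatKernel_holds hτ).norm).mul_const C).mono' hm
      (Eventually.of_forall fun y => ?_)
    rw [norm_smul]
    exact mul_le_mul_of_nonneg_left (hC _) (norm_nonneg _)
  have hint' : Integrable (fun y : E => UnboundedOperators.heatKernel τ y • c) (volume : Measure E) :=
    (UnboundedOperators.integrable_heatKernel_holds hτ).smul_const c
  simp_rw [smul_add]
  rw [integral_add hint hint', integral_smul_const,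
    UnboundedOperators.integral_heatKernel_eq_one_holds hτ, one_smul]

variable (hE : Module.finrank ℝ E = 3)
include hE

/-- **The drift-mild identity in Oseen form, for the full velocity.** For a drift-mild pair
`(U, b)` on `(0, T)` (KNSS 2009, Lemma 3.1: `U(t) = e^{(t-s)Δ}U(s) - ∫ₛᵗ e^{(t-σ)Δ}P∇·(V ⊗ V) dσ`,
`V = U + b`) and `0 < s < t < T`, everywhere in `x`:
`V(t, x) = e^{(t-s)Δ}V(s)(x) - B¹ₛ(V, V)(t)(x) + (b(t) - b(s))`
(`e^{τΔ}` of the constant `b(s)` is `b(s)`; the drift-Duhamel term only sees `V` and is the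
tree's `oseenDuhamel`, `driftDuhamel_zero_eq_oseenDuhamel`). [cite: KochNadirashviliSereginSverak2009, §3 Lemma 3.1 and §4 (4.3) (arXiv:0709.3599v1 pp. 7–8)] -/
theorem IsKNSSDriftMild.add_drift_eq_heatExtension_sub_oseenDuhamel {T N : ℝ} {U V : ℝ → E → E}
    {b : ℝ → E} (h : IsKNSSDriftMild T N U b) (hV : ∀ σ y, V σ y = U σ y + b σ)
    {s t : ℝ} (hs : 0 < s) (hst : s < t) (htT : t < T) (x : E) :
    V t x = UnboundedOperators.heatExtension (V s) (t - s) x - oseenDuhamel 1 s V V t x +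
      (b t - b s) := by
  have hsT : s < T := hst.trans htT
  have hmild := h.mild s t hs hst htT x
  -- the caloric part
  have hUs : AEStronglyMeasurable (U s) volume :=
    (h.measurable.comp (measurable_const.prodMk measurable_id) : Measurable (U s)).aestronglyMeasurable
  have hVs : V s = fun y => U s y + b s := funext fun y => hV s y
  have hheat : UnboundedOperators.heatExtension (V s) (t - s) x =
      UnboundedOperators.heatExtension (U s) (t - s) x + b s := by
    rw [hVs]
    exact heatExtension_add_const_apply hUs (fun y => h.norm_le s ⟨hs, hsT⟩ y) (b s)
      (sub_pos.2 hst) x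
  -- the Duhamel part
  have hVm : ∀ σ, Measurable (V σ) := fun σ => by
    have h1 : V σ = fun y => U σ y + b σ := funext fun y => hV σ y
    rw [h1]
    exact (h.measurable.comp (measurable_const.prodMk measurable_id) : Measurable (U σ)).add_const _
  have hVN : ∀ σ ∈ Ioo 0 T, ∀ y, ‖V σ y‖ ≤ N + N := fun σ hσ y => by
    rw [hV σ y]
    exact (norm_add_le _ _).trans (add_le_add (h.norm_le σ hσ y) (h.norm_drift_le σ))
  have hT : driftTensor U b = driftTensor V 0 := by
    funext σ j k y
    simp only [driftTensor_apply, Pi.zero_apply, add_zero, hV σ y]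
  have hdrift : driftDuhamel U b s t x = oseenDuhamel 1 s V V t x := by
    have h1 : driftDuhamel U b s t x = driftDuhamel V 0 s t x := by
      rw [driftDuhamel_apply, driftDuhamel_apply, hT]
    rw [h1]
    exact driftDuhamel_zero_eq_oseenDuhamel hE (fun σ _ => hVm σ)
      (fun σ hσ y => hVN σ ⟨hs.trans hσ.1, hσ.2.trans htT⟩ y) hst.le x
  rw [hV t x, hmild, hheat, hdrift]
  abel

end Identity

/-! ### Minkowski's inequality for the Oseen–Duhamel term from a general initial time -/

section Minkowski

omit [NormedAddCommGroup E] [InnerProductSpace ℝ E] [FiniteDimensional ℝ E] [BorelSpace E] in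
/-- Slices of a jointly measurable field are measurable.  DUPLICATE (dedup-00641) of Mathlib's
`Measurable.of_uncurry_left` (`Mathlib/MeasureTheory/MeasurableSpace/Constructions.lean`); kept
only as a deprecated name — write `hV.of_uncurry_left`. [folklore] -/
@[deprecated Measurable.of_uncurry_left (since := "2026-08-15")]
theorem measurable_slice_of_uncurry {V : ℝ → E → E} (hV : Measurable (uncurry V)) (σ : ℝ) :
    Measurable (V σ) :=
  hV.of_uncurry_left

/-- **Minkowski in time for the Oseen–Duhamel term** from the initial time `s`:
`‖B¹ₛ(V,W)(t)‖_{L^p} ≤ ∫_{(s,t)} ‖T_{t-σ}[V(σ), W(σ)]‖_{L^p} dσ` for jointly measurable fields and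
`1 ≤ p < ∞` (`Literature.Analysis.FunctionSpaces.eLpNorm_integral_le_lintegral_eLpNorm`). [folklore] -/
theorem eLpNorm_oseenDuhamel_one_le_lintegral {V W : ℝ → E → E} (hV : Measurable (uncurry V))
    (hW : Measurable (uncurry W)) {p : ℝ≥0∞} (hp1 : 1 ≤ p) (hp : p ≠ ∞) (s t : ℝ) :
    eLpNorm (oseenDuhamel 1 s V W t) p volume ≤
      ∫⁻ σ in Ioo s t,
        eLpNorm (fun x => ∫ y, oseenKernel (t - σ) (x - y) (V σ y) (W σ y)) p volume := by
  have h1 : oseenDuhamel 1 s V W t =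
      fun x => ∫ σ in Ioo s t, ∫ y, oseenKernel (t - σ) (x - y) (V σ y) (W σ y) := by
    funext x
    simp only [oseenDuhamel_apply, one_mul]
  rw [h1]
  exact FunctionSpaces.eLpNorm_integral_le_lintegral_eLpNorm (μ := (volume : Measure E))
    (ν := volume.restrict (Ioo s t))
    (KatoLp.aestronglyMeasurable_oseenIntegrand_swap_one hV hW t _) hp1 hp

end Minkowski

/-! ### The window-level `L^p` stability theorem -/

section Stability

variable (hE : Module.finrank ℝ E = 3)
include hE

omit hE in
/-- Measurability of `σ ↦ ‖V(σ)‖_{L^p}` for a jointly measurable field (Tonelli). [folklore] -/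
theorem measurable_eLpNorm_slice_of_uncurry {V : ℝ → E → E} (hV : Measurable (uncurry V))
    {p : ℝ≥0∞} (hp0 : p ≠ 0) (hp : p ≠ ∞) :
    Measurable fun σ => eLpNorm (V σ) p (volume : Measure E) := by
  have h1 : (fun σ => eLpNorm (V σ) p (volume : Measure E)) =
      fun σ => (∫⁻ y, ‖uncurry V (σ, y)‖ₑ ^ p.toReal) ^ (1 / p.toReal) := by
    funext σ
    rw [eLpNorm_eq_lintegral_rpow_enorm_toReal hp0 hp]
    rfl
  rw [h1]
  exact ((hV.enorm.pow_const _).lintegral_prod_right').pow_const _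

omit hE in
/-- A constant function on `E` with finite `L^p` norm, `0 < p < ∞`, vanishes (`|E| = ∞`).
[folklore] -/
theorem eq_zero_of_eLpNorm_const_lt_top [Nontrivial E] {c : E} {p : ℝ≥0∞} (hp0 : p ≠ 0)
    (hp : p ≠ ∞) (h : eLpNorm (fun _ : E => c) p (volume : Measure E) < ∞) : c = 0 := by
  rcases (eLpNorm_const_lt_top_iff hp0 hp).1 h with h0 | hμ
  · exact h0
  · rw [measure_univ_of_isAddLeftInvariant] at hμ
    exact absurd hμ (lt_irrefl _)

/-- **Small-data `L^p` stability on a window** (the heart of the discharge of Seregin 2014,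
Thm. 4.12). Let `3 < p < ∞`, `l > 2`, `dim E = 3`. There is `η > 0` (depending on `p` and `E`
only) such that: for every drift-mild pair `(U, b)` on `(0, T)` with bound `N`
(`IsKNSSDriftMild T N U b`) and full velocity `V = U + b` with `∫_{(0,T)} ‖V(σ)‖_{L^p}^l dσ < ∞`,
and every `0 < s < T` with `‖V(s)‖_{L^p} < ∞` and
`‖V(s)‖_{L^p} · (T - s)^{1/2 - 3/(2p)} ≤ η`, one has `‖V(t)‖_{L^p} ≤ 4 ‖V(s)‖_{L^p}` for a.e.
`t ∈ (s, T)`. Steps 1–4 of the module docstring: the Oseen identity for `V`, Minkowski and the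
two slice bounds, vanishing of the drift increments `b(t) - b(s)` between `L^p` times, and the
Volterra bootstrap `ae_le_four_mul_of_volterra_bootstrap`. (A small-data stability estimate in
the subcritical space `L^p`, `p > 3`, in the manner of Kato 1984, §2; not a printed statement of
Seregin's notes, whose Thm. 4.12 it serves.) [folklore] -/
theorem IsKNSSDriftMild.exists_eta_ae_eLpNorm_le_four_mul {p : ℝ≥0∞} (hp₃ : 3 < p)
    (hp : p < ∞) {l : ℝ} (hl : 2 < l) :
    ∃ η : ℝ≥0∞, 0 < η ∧ ∀ ⦃T N : ℝ⦄ ⦃U V : ℝ → E → E⦄ ⦃b : ℝ → E⦄,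
      IsKNSSDriftMild T N U b → (∀ σ y, V σ y = U σ y + b σ) →
      (∫⁻ σ in Ioo 0 T, eLpNorm (V σ) p volume ^ l) ≠ ∞ →
      ∀ ⦃s : ℝ⦄, 0 < s → s < T → eLpNorm (V s) p volume ≠ ∞ →
      eLpNorm (V s) p volume * ENNReal.ofReal ((T - s) ^ (1 / 2 - 3 / (2 * p.toReal))) ≤ η →
      ∀ᵐ t ∂(volume.restrict (Ioo s T)), eLpNorm (V t) p volume ≤ 4 * eLpNorm (V s) p volume := by
  haveI : Nontrivial E := Module.nontrivial_of_finrank_pos (R := ℝ) (by rw [hE]; norm_num)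
  -- ### constants
  obtain ⟨C₁, hC₁0, hS₁⟩ := KatoLp.exists_eLpNorm_oseenSlice_le_Lp hE hp₃ hp
  have hp1' : 1 < p := lt_trans (by norm_num) hp₃
  have hp1 : 1 ≤ p := hp1'.le
  have hp0 : p ≠ 0 := (zero_lt_one.trans hp1').ne'
  obtain ⟨C₂, hC₂0, hS₂⟩ := exists_eLpNorm_oseenSlice_le (E := E) (p := p) (q := p) hp1' hp.ne le_rfl
  have hr3 : 3 < p.toReal := KatoLp.three_lt_toReal hp₃ hp
  set a : ℝ := 3 / (2 * p.toReal) with ha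
  have ha0 : 0 < a := by positivity
  have ha2 : a < 1 / 2 := by
    rw [ha, div_lt_div_iff₀ (by positivity) (by norm_num)]; linarith
  have hexp : (1 : ℝ) / 2 - 3 / (2 * p.toReal) = 1 / 2 - a := by rw [ha]
  set K : ℝ≥0∞ := 16 * ENNReal.ofReal C₁ * ENNReal.ofReal (1 / (1 / 2 - a)) with hK
  have hKtop : K ≠ ∞ := ENNReal.mul_ne_top (ENNReal.mul_ne_top (by norm_num) ENNReal.ofReal_ne_top)
    ENNReal.ofReal_ne_top
  have hK1top : K + 1 ≠ ∞ := ENNReal.add_ne_top.2 ⟨hKtop, ENNReal.one_ne_top⟩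
  refine ⟨(K + 1)⁻¹, ENNReal.inv_pos.2 hK1top, ?_⟩
  intro T N U V b h hV hL s hs hsT hδ hsmall
  -- ### the field `V`: measurability and bounds
  have hVeq : V = fun σ y => U σ y + b σ := funext fun σ => funext fun y => hV σ y
  have hVm : Measurable (uncurry V) := by
    rw [hVeq]
    exact h.measurable.add (h.measurable_drift.comp measurable_fst)
  have hVsl : ∀ σ, Measurable (V σ) := fun σ => hVm.of_uncurry_left
  have hVN : ∀ σ ∈ Ioo 0 T, ∀ y, ‖V σ y‖ ≤ N + N := fun σ hσ y => by
    rw [hV σ y]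
    exact (norm_add_le _ _).trans (add_le_add (h.norm_le σ hσ y) (h.norm_drift_le σ))
  have hN0 : 0 ≤ N := h.nonneg
  have hVtop : ∀ σ ∈ Ioo 0 T, eLpNorm (V σ) ∞ volume ≤ ENNReal.ofReal (N + N) := fun σ hσ => by
    rw [eLpNorm_exponent_top]
    exact eLpNormEssSup_le_of_ae_enorm_bound (Eventually.of_forall fun y => by
      rw [← ofReal_norm]; exact ENNReal.ofReal_le_ofReal (hVN σ hσ y))
  -- ### the size function `n`
  set n : ℝ → ℝ≥0∞ := fun σ => eLpNorm (V σ) p volume with hn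
  have hnm : Measurable n := measurable_eLpNorm_slice_of_uncurry hVm hp0 hp.ne
  set δ : ℝ≥0∞ := n s with hδdef
  -- the two kernels
  set k₁ : ℝ → ℝ → ℝ≥0∞ := fun t σ => ENNReal.ofReal ((t - σ) ^ (-(1 / 2 + a))) with hk₁
  set k₂ : ℝ → ℝ → ℝ≥0∞ := fun t σ => ENNReal.ofReal ((t - σ) ^ (-(1 / 2 : ℝ))) with hk₂
  set C₂' : ℝ≥0∞ := ENNReal.ofReal C₂ * ENNReal.ofReal (N + N) with hC₂'
  have hC₂'top : C₂' ≠ ∞ := ENNReal.mul_ne_top ENNReal.ofReal_ne_top ENNReal.ofReal_ne_top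
  -- ### the slices `T_{t-σ}[V(σ), V(σ)]` and their two bounds
  set S : ℝ → ℝ → E → E := fun t σ x => ∫ y, oseenKernel (t - σ) (x - y) (V σ y) (V σ y) with hS
  have hS1 : ∀ t σ, σ < t → eLpNorm (S t σ) p volume ≤ ENNReal.ofReal C₁ * (k₁ t σ * n σ ^ 2) := by
    intro t σ hσt
    have h1 := hS₁ (sub_pos.2 hσt) (hVsl σ).aestronglyMeasurable (hVsl σ).aestronglyMeasurable
    refine h1.trans (le_of_eq ?_)
    rw [ENNReal.ofReal_mul hC₁0, hk₁, ha, sq, mul_assoc]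
  have hS2 : ∀ t, ∀ σ ∈ Ioo 0 T, σ < t → eLpNorm (S t σ) p volume ≤ C₂' * (k₂ t σ * n σ) := by
    intro t σ hσ hσt
    haveI : ENNReal.HolderTriple ⊤ p p := ⟨by simp⟩
    have h1 := hS₂ (sub_pos.2 hσt) (hVsl σ).aestronglyMeasurable (hVsl σ).aestronglyMeasurable
    have h2 : eLpNorm (fun y => ‖V σ y‖ * ‖V σ y‖) p volume ≤ ENNReal.ofReal (N + N) * n σ :=
      (eLpNorm_norm_mul_norm_le (hVsl σ).aestronglyMeasurable (hVsl σ).aestronglyMeasurable ⊤ p p).trans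
        (mul_le_mul' (hVtop σ hσ) le_rfl)
    refine h1.trans ?_
    simp only [sub_self, mul_zero, sub_zero] at ⊢
    rw [ENNReal.ofReal_mul hC₂0]
    calc ENNReal.ofReal C₂ * ENNReal.ofReal ((t - σ) ^ (-(1 / 2 : ℝ))) *
          eLpNorm (fun y => ‖V σ y‖ * ‖V σ y‖) p volume
        ≤ ENNReal.ofReal C₂ * ENNReal.ofReal ((t - σ) ^ (-(1 / 2 : ℝ))) *
          (ENNReal.ofReal (N + N) * n σ) := mul_le_mul' le_rfl h2
      _ = C₂' * (k₂ t σ * n σ) := by rw [hC₂', hk₂]; ring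
  -- ### the split bound for the Duhamel term
  have hDsplit : ∀ t ∈ Ioo s T, ∀ t₁ ∈ Icc s t,
      eLpNorm (oseenDuhamel 1 s V V t) p volume ≤
        ENNReal.ofReal C₁ * (∫⁻ σ in Ioo s t₁, k₁ t σ * n σ ^ 2) +
          C₂' * ∫⁻ σ in Ioo t₁ t, k₂ t σ * n σ := by
    intro t ht t₁ ht₁
    have hM := eLpNorm_oseenDuhamel_one_le_lintegral hVm hVm hp1 hp.ne s t
    refine hM.trans ?_
    have hsub : Ioo s t ⊆ Ioo s t₁ ∪ Ico t₁ t := fun σ hσ => by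
      rcases lt_or_ge σ t₁ with h' | h'
      · exact Or.inl ⟨hσ.1, h'⟩
      · exact Or.inr ⟨h', hσ.2⟩
    calc ∫⁻ σ in Ioo s t, eLpNorm (S t σ) p volume
        ≤ ∫⁻ σ in Ioo s t₁ ∪ Ico t₁ t, eLpNorm (S t σ) p volume := lintegral_mono_set hsub
      _ ≤ (∫⁻ σ in Ioo s t₁, eLpNorm (S t σ) p volume) + ∫⁻ σ in Ico t₁ t, eLpNorm (S t σ) p volume :=
          lintegral_union_le _ _ _
      _ = (∫⁻ σ in Ioo s t₁, eLpNorm (S t σ) p volume) + ∫⁻ σ in Ioo t₁ t, eLpNorm (S t σ) p volume := by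
          rw [setLIntegral_congr (Ioo_ae_eq_Ico (μ := (volume : Measure ℝ)) (a := t₁) (b := t))]
      _ ≤ (∫⁻ σ in Ioo s t₁, ENNReal.ofReal C₁ * (k₁ t σ * n σ ^ 2)) +
            ∫⁻ σ in Ioo t₁ t, C₂' * (k₂ t σ * n σ) := by
          refine add_le_add (setLIntegral_mono' measurableSet_Ioo fun σ hσ => ?_)
            (setLIntegral_mono' measurableSet_Ioo fun σ hσ => ?_)
          · exact hS1 t σ (hσ.2.trans_le ht₁.2)
          · exact hS2 t σ ⟨hs.trans_le (ht₁.1.trans hσ.1.le), hσ.2.trans ht.2⟩ hσ.2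
      _ = ENNReal.ofReal C₁ * (∫⁻ σ in Ioo s t₁, k₁ t σ * n σ ^ 2) +
            C₂' * ∫⁻ σ in Ioo t₁ t, k₂ t σ * n σ := by
          rw [lintegral_const_mul' _ _ ENNReal.ofReal_ne_top, lintegral_const_mul' _ _ hC₂'top]
  -- ### the a priori bound (Hölder in time) and finiteness of the Duhamel term
  have hLs : (∫⁻ σ in Ioo s T, n σ ^ l) ≠ ∞ :=
    ne_top_of_le_ne_top hL (lintegral_mono_set (Ioo_subset_Ioo_left hs.le))
  obtain ⟨B, hBtop, hB⟩ := exists_forall_lintegral_rpow_neg_half_mul_le hl hnm.aemeasurable hLs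
  have hDfin : ∀ t ∈ Ioo s T, eLpNorm (oseenDuhamel 1 s V V t) p volume ≤ C₂' * B := by
    intro t ht
    have h1 := hDsplit t ht s ⟨le_rfl, ht.1.le⟩
    rw [Ioo_self, Measure.restrict_empty, lintegral_zero_measure, mul_zero, zero_add] at h1
    exact h1.trans (mul_le_mul' le_rfl (hB t ⟨ht.1, ht.2.le⟩))
  -- ### the caloric term
  have hVs_mem : MemLp (V s) p volume := ⟨(hVsl s).aestronglyMeasurable, lt_top_iff_ne_top.2 hδ⟩
  have hheat_le : ∀ t, s < t →
      eLpNorm (UnboundedOperators.heatExtension (V s) (t - s)) p volume ≤ δ := fun t hst =>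
    UnboundedOperators.eLpNorm_heatExtension_le_holds hVs_mem hp1 (sub_pos.2 hst)
  have hheat_m : ∀ t, s < t →
      AEStronglyMeasurable (UnboundedOperators.heatExtension (V s) (t - s)) volume := fun t hst =>
    (UnboundedOperators.memLp_heatExtension_holds hVs_mem hp1 (sub_pos.2 hst)).1
  -- measurability of the Duhamel term, read off the identity
  have hD_m : ∀ t ∈ Ioo s T, AEStronglyMeasurable (oseenDuhamel 1 s V V t) volume := by
    intro t ht
    have h1 : oseenDuhamel 1 s V V t = fun x =>
        UnboundedOperators.heatExtension (V s) (t - s) x - V t x + (b t - b s) := by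
      funext x
      have h2 := h.add_drift_eq_heatExtension_sub_oseenDuhamel hE hV hs ht.1 ht.2 x
      rw [h2]; abel
    rw [h1]
    exact ((hheat_m t ht.1).sub (hVsl t).aestronglyMeasurable).add aestronglyMeasurable_const
  -- ### the drift increments vanish between `L^p` times
  have hb : ∀ t ∈ Ioo s T, n t ≠ ∞ → b t = b s := by
    intro t ht hnt
    have hconst : (fun _ : E => b t - b s) = fun x =>
        V t x - UnboundedOperators.heatExtension (V s) (t - s) x + oseenDuhamel 1 s V V t x := by
      funext x
      have h2 := h.add_drift_eq_heatExtension_sub_oseenDuhamel hE hV hs ht.1 ht.2 x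
      rw [h2]; abel
    have hlt : eLpNorm (fun _ : E => b t - b s) p volume < ∞ := by
      rw [hconst]
      have h3 : eLpNorm (fun x => V t x - UnboundedOperators.heatExtension (V s) (t - s) x +
          oseenDuhamel 1 s V V t x) p volume ≤
          (n t + δ) + C₂' * B := by
        calc eLpNorm (fun x => V t x - UnboundedOperators.heatExtension (V s) (t - s) x +
              oseenDuhamel 1 s V V t x) p volume
            ≤ eLpNorm (fun x => V t x - UnboundedOperators.heatExtension (V s) (t - s) x) p volume +
                eLpNorm (oseenDuhamel 1 s V V t) p volume :=
              eLpNorm_add_le ((hVsl t).aestronglyMeasurable.sub (hheat_m t ht.1)) (hD_m t ht) hp1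
          _ ≤ (eLpNorm (V t) p volume +
                eLpNorm (UnboundedOperators.heatExtension (V s) (t - s)) p volume) + C₂' * B :=
              add_le_add (eLpNorm_sub_le (hVsl t).aestronglyMeasurable (hheat_m t ht.1) hp1)
                (hDfin t ht)
          _ ≤ (n t + δ) + C₂' * B := add_le_add (add_le_add le_rfl (hheat_le t ht.1)) le_rfl
      refine lt_of_le_of_lt h3 ?_
      exact ENNReal.add_lt_top.2 ⟨ENNReal.add_lt_top.2 ⟨lt_top_iff_ne_top.2 hnt,
        lt_top_iff_ne_top.2 hδ⟩, ENNReal.mul_lt_top (lt_top_iff_ne_top.2 hC₂'top)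
          (lt_top_iff_ne_top.2 hBtop)⟩
    exact sub_eq_zero.1 (eq_zero_of_eLpNorm_const_lt_top hp0 hp.ne hlt)
  -- ### the Volterra inequality for `n`
  have hnfin : ∀ᵐ t ∂(volume.restrict (Ioo s T)), n t < ∞ := by
    have hl0 : 0 < l := by linarith
    have h1 : ∀ᵐ t ∂(volume.restrict (Ioo s T)), n t ^ l < ∞ :=
      ae_lt_top' (hnm.pow_const _).aemeasurable hLs
    filter_upwards [h1] with t ht
    exact (ENNReal.rpow_lt_top_iff_of_pos hl0).1 ht
  have hineq : ∀ᵐ t ∂(volume.restrict (Ioo s T)), ∀ t₁ ∈ Icc s t,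
      n t ≤ δ + ENNReal.ofReal C₁ * (∫⁻ σ in Ioo s t₁, k₁ t σ * n σ ^ 2) +
        C₂' * ∫⁻ σ in Ioo t₁ t, k₂ t σ * n σ := by
    filter_upwards [hnfin, ae_restrict_mem measurableSet_Ioo] with t hnt ht t₁ ht₁
    have hbt := hb t ht hnt.ne
    have hVt : V t = fun x => UnboundedOperators.heatExtension (V s) (t - s) x -
        oseenDuhamel 1 s V V t x := by
      funext x
      rw [h.add_drift_eq_heatExtension_sub_oseenDuhamel hE hV hs ht.1 ht.2 x, hbt, sub_self,
        add_zero]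
    calc n t = eLpNorm (V t) p volume := rfl
      _ ≤ eLpNorm (UnboundedOperators.heatExtension (V s) (t - s)) p volume +
            eLpNorm (oseenDuhamel 1 s V V t) p volume := by
          rw [hVt]
          exact eLpNorm_sub_le (hheat_m t ht.1) (hD_m t ht) hp1
      _ ≤ δ + (ENNReal.ofReal C₁ * (∫⁻ σ in Ioo s t₁, k₁ t σ * n σ ^ 2) +
            C₂' * ∫⁻ σ in Ioo t₁ t, k₂ t σ * n σ) :=
          add_le_add (hheat_le t ht.1) (hDsplit t ht t₁ ht₁)
      _ = _ := (add_assoc _ _ _).symm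
  have hfin : ∀ᵐ t ∂(volume.restrict (Ioo s T)), n t ≤ δ + C₂' * B := by
    filter_upwards [hineq, ae_restrict_mem measurableSet_Ioo] with t ht htI
    have h1 := ht s ⟨le_rfl, htI.1.le⟩
    rw [Ioo_self, Measure.restrict_empty, lintegral_zero_measure, mul_zero, add_zero] at h1
    exact h1.trans (add_le_add le_rfl (mul_le_mul' le_rfl (hB t ⟨htI.1, htI.2.le⟩)))
  -- ### smallness and the bootstrap
  have hsm : 16 * ENNReal.ofReal C₁ * δ * ENNReal.ofReal ((T - s) ^ (1 / 2 - a) / (1 / 2 - a)) ≤ 1 := by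
    have hTs : 0 ≤ T - s := by linarith
    have h1 : ENNReal.ofReal ((T - s) ^ (1 / 2 - a) / (1 / 2 - a)) =
        ENNReal.ofReal ((T - s) ^ (1 / 2 - a)) * ENNReal.ofReal (1 / (1 / 2 - a)) := by
      rw [← ENNReal.ofReal_mul (Real.rpow_nonneg hTs _), mul_one_div]
    rw [hexp] at hsmall
    calc 16 * ENNReal.ofReal C₁ * δ * ENNReal.ofReal ((T - s) ^ (1 / 2 - a) / (1 / 2 - a))
        = K * (δ * ENNReal.ofReal ((T - s) ^ (1 / 2 - a))) := by rw [h1, hK]; ring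
      _ ≤ (K + 1) * (K + 1)⁻¹ := mul_le_mul' le_self_add hsmall
      _ = 1 := ENNReal.mul_inv_cancel (by simp) hK1top
  have hboot := ae_le_four_mul_of_volterra_bootstrap (n := n) (s := s) (T := T) (δ := δ)
    (C₁ := ENNReal.ofReal C₁) (C₂ := C₂') hC₂'top ha2
    (ENNReal.add_ne_top.2 ⟨hδ, ENNReal.mul_ne_top hC₂'top hBtop⟩) hfin hineq hsm
  exact hboot

end Stability

end Literature.Analysis.FluidPDE

end
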